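import Literature.NumberTheory.Automorphic.AdelicPiSchwartzBruhatFourier
import Literature.NumberTheory.Automorphic.AdicCompletionCompact
import Literature.NumberTheory.Automorphic.FinAdelicTotallyDisconnected
import Mathlib.Analysis.Calculus.BumpFunction.FiniteDimension
import Mathlib.Topology.ContinuousMap.StoneWeierstrass
import Mathlib.Topology.ContinuousMap.CompactlySupported
import HarnessLib

/-!
# Real Schwartz–Bruhat functions on `𝔸_K^ι`: cut-offs, separation, uniform density in `C_c`, sandwiches

Topic `NumberTheory/Automorphic`; namespace `Literature.NumberTheory.Automorphic`. KERNEL MATHEMATICS ONLY: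
no `def … : Prop` records, no `axiom`, no `sorry`; every `[cite: …]` tag is provenance for a
kernel-checked statement.

For a number field `K` and a finite index type `ι` let `X = 𝔸_K^ι` and `𝒮(X) = piSchwartzBruhat K ι`
(`AdelicPiSchwartzBruhatFourier`: the span of the tensors `Φ_∞ ⊗ Φ_f`, `Φ_∞` Schwartz on `(K ⊗ ℝ)^ι`,
`Φ_f` locally constant of compact support on `(𝔸_K^∞)^ι`). This file supplies the elementary
"richness" of the REAL Schwartz–Bruhat functions `𝒮_ℝ(X) = {Ψ : X → ℝ | Ψ ∈ 𝒮(X)}`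
(`piSchwartzBruhatReal`) that turns positive linear functionals on `𝒮(X)` into positive Radon measures
(Weil 1965, Chap. I n° 2, Lemme 3: "une distribution tempérée positive est une mesure positive"; the
tree's `MeasureTheory/RieszRepresentation/PositiveFunctionalExtension`):

* §1 `mul_mem_piSchwartzBruhat` — `𝒮(X)` is an algebra under pointwise multiplication (Schwartz ×
  Schwartz via Mathlib `SchwartzMap.smulLeftCLM`; locally constant compactly supported factors
  multiply); `piSchwartzBruhatReal`, `mul_mem_piSchwartzBruhatReal`, `continuous_of_mem_piSchwartzBruhatReal`.
* §2 `exists_piSchwartzBruhatReal_cutoff` — **smooth Urysohn cut-offs in `𝒮_ℝ(X)`**: for `K₀ ⊆ U`,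
  `K₀` compact, `U` open, a `Ψ ∈ 𝒮_ℝ(X)` with `0 ≤ Ψ ≤ 1`, `Ψ = 1` on `K₀`, `tsupport Ψ ⊆ U` compact
  (finite subcover of `K₀` by boxes `ball × compact-open` along `X ≅ (K ⊗ ℝ)^ι × (𝔸_K^∞)^ι`
  (`piAdeleSplit`), bump functions (Mathlib `ContDiffBump`) tensor indicators, and `1 - ∏ (1 - Ψ_j)`).
* §3 `exists_piSchwartzBruhatReal_apply_ne` — `𝒮_ℝ(X)` separates the points of `X`.
* §4 `exists_piSchwartzBruhatReal_near` — **uniform density with support control**: every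
  `g ∈ C_c(X, ℝ)` with `tsupport g ⊆ U` is a uniform limit of `Ψ ∈ 𝒮_ℝ(X)` with `tsupport Ψ ⊆ U`
  (Stone–Weierstrass on a compact neighbourhood, Mathlib
  `ContinuousMap.exists_mem_subalgebra_near_continuousMap_of_separatesPoints`, then a cut-off).
* §5 `piSchwartzBruhatReal_sandwich` — **the Darboux–Daniell sandwich**: for every POSITIVE linear
  functional `S` on `𝒮_ℝ(X)`, every `g ∈ C_c(X, ℝ)` and `ε > 0` there are `Ψ₁ ≤ g ≤ Ψ₂` in `𝒮_ℝ(X)`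
  (continuous, compactly supported inside any prescribed open `U ⊇ tsupport g`) with `S Ψ₂ ≤ S Ψ₁ + ε`
  — hypothesis `hL` of `PositiveFunctionalExtension` for `L = 𝒮_ℝ(X)`.

These are the standard facts "𝒮 is a dense subalgebra of `C_c`/`C_0`" for adelic spaces (Weil, *Basic
Number Theory*, Ch. VII §2; Tate's thesis §3.2–4.2 for the factors), written for the tree's concrete
model. Consumers: Weil's Siegel–Eisenstein fibre measures (`Weil1965/AdelicFibreMeasures`) and their
theta-side analogues.

## References

* A. Weil, *Sur la formule de Siegel dans la théorie des groupes classiques*, Acta Math. 113 (1965):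
  Chap. I n° 2, Lemmes 2–3, p. 7 [Weil1965].
* A. Weil, *Basic Number Theory* (1967), Ch. VII §2 (standard functions on adele spaces) [WeilBNT1967].
* W. Rudin, *Real and Complex Analysis*, 3rd ed. (1987), Thm. 2.14, Lemma 2.12 [Rudin1987].
-/

noncomputable section

open MeasureTheory NumberField NumberField.InfinitePlace NumberField.mixedEmbedding IsDedekindDomain
  Filter Topology Set Metric CompactlySupported
open scoped SchwartzMap Classical

namespace Literature.NumberTheory.Automorphic

variable (K : Type) [Field K] [NumberField K] (ι : Type) [Fintype ι]

/-! ### §1 The algebra of (real) Schwartz–Bruhat functions -/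

omit [Fintype ι] in
/-- `𝔸_K^ι` is Hausdorff (Mathlib instances on `K_∞ × 𝔸_K^∞`). [folklore] -/
private theorem t2Space_piAdele : T2Space (ι → AdeleRing (𝓞 K) K) := by
  haveI : T2Space (FiniteAdeleRing (𝓞 K) K) := inferInstanceAs <| T2Space
    (RestrictedProduct (fun w : IsDedekindDomain.HeightOneSpectrum (𝓞 K) => w.adicCompletion K)
      (fun w => (w.adicCompletionIntegers K : Set (w.adicCompletion K))) Filter.cofinite)
  haveI : T2Space (InfiniteAdeleRing K) :=
    inferInstanceAs <| T2Space ((w : InfinitePlace K) → w.Completion)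
  haveI : T2Space (AdeleRing (𝓞 K) K) :=
    inferInstanceAs <| T2Space (InfiniteAdeleRing K × FiniteAdeleRing (𝓞 K) K)
  infer_instance

omit [Fintype ι] in
/-- `(𝔸_K^∞)^ι` is Hausdorff. [folklore] -/
private theorem t2Space_piFiniteAdele : T2Space (ι → FiniteAdeleRing (𝓞 K) K) := by
  haveI : T2Space (FiniteAdeleRing (𝓞 K) K) := inferInstanceAs <| T2Space
    (RestrictedProduct (fun w : IsDedekindDomain.HeightOneSpectrum (𝓞 K) => w.adicCompletion K)
      (fun w => (w.adicCompletionIntegers K : Set (w.adicCompletion K))) Filter.cofinite)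
  infer_instance

omit [Fintype ι] in
/-- `(𝔸_K^∞)^ι` is totally disconnected (tree: `totallyDisconnectedSpace_finiteAdeleRing`).
[cite: WeilBNT1967, Ch. VII §2] -/
private theorem totallyDisconnectedSpace_piFiniteAdele :
    TotallyDisconnectedSpace (ι → FiniteAdeleRing (𝓞 K) K) := by
  haveI := totallyDisconnectedSpace_finiteAdeleRing (E := K)
  infer_instance

variable {K ι}

/-- **`𝒮(𝔸_K^ι)` is closed under pointwise multiplication.** Tensors multiply factorwise: the product of
two Schwartz functions is Schwartz (Mathlib `SchwartzMap.smulLeftCLM` with the temperate growth of a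
Schwartz function), the product of two locally constant compactly supported functions is such.
[cite: WeilBNT1967, Ch. VII §2] -/
theorem mul_mem_piSchwartzBruhat {Φ Ψ : (ι → AdeleRing (𝓞 K) K) → ℂ}
    (hΦ : Φ ∈ piSchwartzBruhat K ι) (hΨ : Ψ ∈ piSchwartzBruhat K ι) :
    Φ * Ψ ∈ piSchwartzBruhat K ι := by
  -- factorizable × factorizable
  have hff : ∀ {Φ Ψ : (ι → AdeleRing (𝓞 K) K) → ℂ}, IsFactorizablePiSchwartzBruhat K ι Φ →
      IsFactorizablePiSchwartzBruhat K ι Ψ → Φ * Ψ ∈ piSchwartzBruhat K ι := by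
    intro Φ Ψ hΦ hΨ
    obtain ⟨Φi, Φf, hΦf, rfl⟩ := hΦ
    obtain ⟨Ψi, Ψf, hΨf, rfl⟩ := hΨ
    refine mem_piSchwartzBruhat ⟨SchwartzMap.smulLeftCLM ℂ (⇑Ψi) Φi, Φf * Ψf,
      ⟨hΦf.1.mul hΨf.1, hΦf.2.mul_right⟩, ?_⟩
    funext v
    simp only [Pi.mul_apply, SchwartzMap.smulLeftCLM_apply_apply Ψi.hasTemperateGrowth,
      smul_eq_mul]
    ring
  -- span × factorizable
  have hsf : ∀ {Ψ : (ι → AdeleRing (𝓞 K) K) → ℂ}, IsFactorizablePiSchwartzBruhat K ι Ψ →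
      ∀ {Φ}, Φ ∈ piSchwartzBruhat K ι → Φ * Ψ ∈ piSchwartzBruhat K ι := by
    intro Ψ hΨ Φ hΦ
    induction hΦ using Submodule.span_induction with
    | mem Φ hΦ => exact hff hΦ hΨ
    | zero => rw [zero_mul]; exact zero_mem _
    | add Φ₁ Φ₂ _ _ h₁ h₂ => rw [add_mul]; exact add_mem h₁ h₂
    | smul c Φ _ h => rw [smul_mul_assoc]; exact Submodule.smul_mem _ c h
  induction hΨ using Submodule.span_induction with
  | mem Ψ hΨ => exact hsf hΨ hΦ
  | zero => rw [mul_zero]; exact zero_mem _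
  | add Ψ₁ Ψ₂ _ _ h₁ h₂ => rw [mul_add]; exact add_mem h₁ h₂
  | smul c Ψ _ h => rw [mul_smul_comm]; exact Submodule.smul_mem _ c h

variable (K ι)

/-- **The real Schwartz–Bruhat functions `𝒮_ℝ(𝔸_K^ι)`**: the real functions `Ψ` whose complexification
`v ↦ (Ψ v : ℂ)` lies in `piSchwartzBruhat K ι`; an `ℝ`-subspace of `𝔸_K^ι → ℝ`.
[cite: Weil1965, Chap. I n° 2, Lemme 3, p. 7] -/
def piSchwartzBruhatReal : Submodule ℝ ((ι → AdeleRing (𝓞 K) K) → ℝ) where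
  carrier := {Ψ | (fun v => (Ψ v : ℂ)) ∈ piSchwartzBruhat K ι}
  add_mem' {Ψ₁ Ψ₂} h₁ h₂ := by
    have h := (piSchwartzBruhat K ι).add_mem (show (fun v => (Ψ₁ v : ℂ)) ∈ _ from h₁)
      (show (fun v => (Ψ₂ v : ℂ)) ∈ _ from h₂)
    show (fun v => ((Ψ₁ + Ψ₂) v : ℂ)) ∈ piSchwartzBruhat K ι
    convert h using 1
    funext v
    simp only [Pi.add_apply, Complex.ofReal_add]
  zero_mem' := by
    show (fun v => ((0 : (ι → AdeleRing (𝓞 K) K) → ℝ) v : ℂ)) ∈ piSchwartzBruhat K ι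
    convert (piSchwartzBruhat K ι).zero_mem using 1
    funext v
    simp only [Pi.zero_apply, Complex.ofReal_zero]
  smul_mem' c Ψ h := by
    have h' := (piSchwartzBruhat K ι).smul_mem (c : ℂ) (show (fun v => (Ψ v : ℂ)) ∈ _ from h)
    show (fun v => ((c • Ψ) v : ℂ)) ∈ piSchwartzBruhat K ι
    convert h' using 1
    funext v
    simp only [Pi.smul_apply, smul_eq_mul, Complex.ofReal_mul]

variable {K ι}

/-- Membership in `𝒮_ℝ(𝔸_K^ι)`. [cite: Weil1965, Chap. I n° 2, Lemme 3, p. 7] -/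
theorem mem_piSchwartzBruhatReal_iff {Ψ : (ι → AdeleRing (𝓞 K) K) → ℝ} :
    Ψ ∈ piSchwartzBruhatReal K ι ↔ (fun v => (Ψ v : ℂ)) ∈ piSchwartzBruhat K ι :=
  Iff.rfl

/-- `𝒮_ℝ(𝔸_K^ι)` is closed under pointwise multiplication. [cite: WeilBNT1967, Ch. VII §2] -/
theorem mul_mem_piSchwartzBruhatReal {Ψ₁ Ψ₂ : (ι → AdeleRing (𝓞 K) K) → ℝ}
    (h₁ : Ψ₁ ∈ piSchwartzBruhatReal K ι) (h₂ : Ψ₂ ∈ piSchwartzBruhatReal K ι) :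
    Ψ₁ * Ψ₂ ∈ piSchwartzBruhatReal K ι := by
  rw [mem_piSchwartzBruhatReal_iff] at h₁ h₂ ⊢
  convert mul_mem_piSchwartzBruhat h₁ h₂ using 1
  funext v
  simp only [Pi.mul_apply, Complex.ofReal_mul]

/-- Real Schwartz–Bruhat functions are continuous. [cite: WeilBNT1967, Ch. VII §2] -/
theorem continuous_of_mem_piSchwartzBruhatReal {Ψ : (ι → AdeleRing (𝓞 K) K) → ℝ}
    (h : Ψ ∈ piSchwartzBruhatReal K ι) : Continuous Ψ := by
  have hc := continuous_of_mem_piSchwartzBruhat h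
  have : Ψ = fun v => ((Ψ v : ℂ)).re := funext fun v => (Complex.ofReal_re _).symm
  rw [this]
  exact Complex.continuous_re.comp hc

/-! ### §2 Cut-offs -/

/-- A **tensor bump** in `𝒮_ℝ(𝔸_K^ι)`: for a smooth bump `b` on `(K ⊗ ℝ)^ι` and a compact open
`C ⊆ (𝔸_K^∞)^ι`, the function `v ↦ b(v_∞) 𝟙_C(v_f)` is a real Schwartz–Bruhat function.
[cite: WeilBNT1967, Ch. VII §2] -/
theorem bump_mul_indicator_mem_piSchwartzBruhatReal {c : ι → mixedSpace K} (b : ContDiffBump c)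
    {C : Set (ι → FiniteAdeleRing (𝓞 K) K)} (hCc : IsCompact C) (hCo : IsOpen C) :
    (fun v => b (piArch K ι v) * C.indicator 1 (piFinite K ι v)) ∈ piSchwartzBruhatReal K ι := by
  rw [mem_piSchwartzBruhatReal_iff]
  have hbs : HasCompactSupport fun x => ((b : (ι → mixedSpace K) → ℝ) x : ℂ) :=
    b.hasCompactSupport.comp_left Complex.ofReal_zero
  have hbd : ContDiff ℝ ((⊤ : ℕ∞) : WithTop ℕ∞) fun x => ((b : (ι → mixedSpace K) → ℝ) x : ℂ) :=
    Complex.ofRealCLM.contDiff.comp b.contDiff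
  refine mem_piSchwartzBruhat ⟨hbs.toSchwartzMap hbd, fun y => (C.indicator 1 y : ℝ), ⟨?_, ?_⟩, ?_⟩
  · -- locally constant: `C` is clopen
    haveI := t2Space_piFiniteAdele K ι
    have hCl : IsClopen C := ⟨hCc.isClosed, hCo⟩
    refine (IsLocallyConstant.iff_exists_open _).mpr fun y => ?_
    by_cases hy : y ∈ C
    · exact ⟨C, hCo, hy, fun y' hy' => by simp [indicator_of_mem hy', indicator_of_mem hy]⟩
    · exact ⟨Cᶜ, hCl.compl.isOpen, hy, fun y' hy' => by
        simp [indicator_of_notMem (show y' ∉ C from hy'), indicator_of_notMem hy]⟩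
  · refine HasCompactSupport.of_support_subset_isCompact hCc fun y hy => ?_
    by_contra hyC
    exact hy (by simp [indicator_of_notMem hyC])
  · funext v
    rw [Complex.ofReal_mul]
    rfl

/-- **Boxes form a neighbourhood basis of `𝔸_K^ι`**: every open `U ∋ x` contains a box
`{v | v_∞ ∈ ball(x_∞, R), v_f ∈ C}` with `R > 0` and `C ∋ x_f` compact open in `(𝔸_K^∞)^ι`
(product topology along `piAdeleSplit`; clopen basis of the totally disconnected locally compact
`(𝔸_K^∞)^ι`). [cite: WeilBNT1967, Ch. VII §2] -/
theorem exists_piAdeleBox_subset {U : Set (ι → AdeleRing (𝓞 K) K)} (hU : IsOpen U)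
    {x : ι → AdeleRing (𝓞 K) K} (hx : x ∈ U) :
    ∃ R : ℝ, 0 < R ∧ ∃ C : Set (ι → FiniteAdeleRing (𝓞 K) K), IsCompact C ∧ IsOpen C ∧
      piFinite K ι x ∈ C ∧
      ∀ v, piArch K ι v ∈ ball (piArch K ι x) R → piFinite K ι v ∈ C → v ∈ U := by
  haveI := t2Space_piFiniteAdele K ι
  haveI := totallyDisconnectedSpace_piFiniteAdele K ι
  haveI := locallyCompactSpace_finiteAdeleRing' (K := K)
  -- pull `U` back to the product
  have hU' : IsOpen ((piAdeleSplit K ι) ⁻¹' U) := hU.preimage (piAdeleSplit K ι).continuous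
  have hx' : (piArch K ι x, piFinite K ι x) ∈ (piAdeleSplit K ι) ⁻¹' U := by
    rw [mem_preimage, ← piAdeleSplit_symm_apply, ContinuousAddEquiv.apply_symm_apply]
    exact hx
  obtain ⟨V, W, hV, hW, hxV, hxW, hVW⟩ := isOpen_prod_iff.mp hU' _ _ hx'
  obtain ⟨R, hR, hRV⟩ := Metric.isOpen_iff.mp hV _ hxV
  -- a compact open `C ∋ x_f` inside `W`
  obtain ⟨N, hNc, hNx⟩ := exists_compact_mem_nhds (piFinite K ι x)
  obtain ⟨C, ⟨hCclopen, hxC, hCsub⟩⟩ :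
      ∃ C : Set (ι → FiniteAdeleRing (𝓞 K) K), IsClopen C ∧ piFinite K ι x ∈ C ∧
        C ⊆ W ∩ interior N := by
    have hO : IsOpen (W ∩ interior N) := hW.inter isOpen_interior
    have hxO : piFinite K ι x ∈ W ∩ interior N := ⟨hxW, mem_interior_iff_mem_nhds.mpr hNx⟩
    obtain ⟨C, hC, hxC, hCO⟩ :=
      (loc_compact_Haus_tot_disc_of_zero_dim (H := ι → FiniteAdeleRing (𝓞 K) K)).exists_subset_of_mem_open
        hxO hO
    exact ⟨C, hC, hxC, hCO⟩
  have hCc : IsCompact C :=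
    hNc.of_isClosed_subset hCclopen.isClosed ((hCsub.trans inter_subset_right).trans interior_subset)
  refine ⟨R, hR, C, hCc, hCclopen.isOpen, hxC, fun v hv hvC => ?_⟩
  have : (piArch K ι v, piFinite K ι v) ∈ (piAdeleSplit K ι) ⁻¹' U :=
    hVW (mk_mem_prod (hRV hv) (hCsub hvC).1)
  rw [mem_preimage, ← piAdeleSplit_symm_apply, ContinuousAddEquiv.apply_symm_apply] at this
  exact this

/-- The box `{v | v_∞ ∈ closedBall(c, r), v_f ∈ C}` (`C` compact) is compact in `𝔸_K^ι`.
[cite: WeilBNT1967, Ch. VII §2] -/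
theorem isCompact_piAdeleBox (c : ι → mixedSpace K) (r : ℝ) {C : Set (ι → FiniteAdeleRing (𝓞 K) K)}
    (hC : IsCompact C) :
    IsCompact (piArch K ι ⁻¹' closedBall c r ∩ piFinite K ι ⁻¹' C) := by
  have himg : piArch K ι ⁻¹' closedBall c r ∩ piFinite K ι ⁻¹' C =
      (piAdeleSplit K ι) '' (closedBall c r ×ˢ C) := by
    ext v
    constructor
    · rintro ⟨h₁, h₂⟩
      exact ⟨(piArch K ι v, piFinite K ι v), mk_mem_prod h₁ h₂, by
        rw [← piAdeleSplit_symm_apply, ContinuousAddEquiv.apply_symm_apply]⟩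
    · rintro ⟨p, hp, rfl⟩
      have h := piAdeleSplit_symm_apply (K := K) (ι := ι) (piAdeleSplit K ι p)
      rw [ContinuousAddEquiv.symm_apply_apply] at h
      have h1 : piArch K ι (piAdeleSplit K ι p) = p.1 := (congrArg Prod.fst h).symm
      have h2 : piFinite K ι (piAdeleSplit K ι p) = p.2 := (congrArg Prod.snd h).symm
      exact ⟨by rw [mem_preimage, h1]; exact hp.1, by rw [mem_preimage, h2]; exact hp.2⟩
  rw [himg]
  exact ((isCompact_closedBall c r).prod hC).image (piAdeleSplit K ι).continuous

/-- **Smooth Urysohn cut-offs in `𝒮_ℝ(𝔸_K^ι)`.** For `K₀ ⊆ U`, `K₀` compact and `U` open, there is a real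
Schwartz–Bruhat function `Ψ`, continuous with compact support inside `U`, `0 ≤ Ψ ≤ 1`, `Ψ = 1` on `K₀`.
(Finite subcover by boxes, tensor bumps `Ψ_j`, and `Ψ = 1 - ∏_j (1 - Ψ_j)`.)
[cite: Weil1965, Chap. I n° 2, Lemme 3, p. 7] -/
theorem exists_piSchwartzBruhatReal_cutoff {K₀ U : Set (ι → AdeleRing (𝓞 K) K)}
    (hK₀ : IsCompact K₀) (hU : IsOpen U) (hKU : K₀ ⊆ U) :
    ∃ Ψ : (ι → AdeleRing (𝓞 K) K) → ℝ, Ψ ∈ piSchwartzBruhatReal K ι ∧ Continuous Ψ ∧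
      HasCompactSupport Ψ ∧ tsupport Ψ ⊆ U ∧ (∀ v, Ψ v ∈ Icc (0 : ℝ) 1) ∧ ∀ v ∈ K₀, Ψ v = 1 := by
  haveI := t2Space_piFiniteAdele K ι
  -- boxes around each point of `K₀`
  choose R hR C hCc hCo hxC hbox using fun x : K₀ => exists_piAdeleBox_subset hU (hKU x.2)
  -- the open quarter-boxes cover `K₀`
  set O : K₀ → Set (ι → AdeleRing (𝓞 K) K) := fun x =>
    piArch K ι ⁻¹' ball (piArch K ι (x : ι → AdeleRing (𝓞 K) K)) (R x / 4) ∩ piFinite K ι ⁻¹' C x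
  have hOo : ∀ x, IsOpen (O x) := fun x =>
    (isOpen_ball.preimage continuous_piArch).inter ((hCo x).preimage continuous_piFinite)
  have hOcov : K₀ ⊆ ⋃ x, O x := fun y hy =>
    mem_iUnion.mpr ⟨⟨y, hy⟩, mem_ball_self (by have := hR ⟨y, hy⟩; positivity), hxC ⟨y, hy⟩⟩
  obtain ⟨t, ht⟩ := hK₀.elim_finite_subcover O hOo hOcov
  -- bumps: `= 1` on `closedBall (R/4)`, supported in `closedBall (R/2) ⊆ ball R`
  set b : ∀ x : K₀, ContDiffBump (piArch K ι (x : ι → AdeleRing (𝓞 K) K)) := fun x =>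
    ⟨R x / 4, R x / 2, by have := hR x; positivity, by have := hR x; linarith⟩
  set B : K₀ → (ι → AdeleRing (𝓞 K) K) → ℝ := fun x v =>
    b x (piArch K ι v) * (C x).indicator 1 (piFinite K ι v)
  have hBmem : ∀ x, B x ∈ piSchwartzBruhatReal K ι := fun x =>
    bump_mul_indicator_mem_piSchwartzBruhatReal (b x) (hCc x) (hCo x)
  have hB01 : ∀ x v, B x v ∈ Icc (0 : ℝ) 1 := fun x v => by
    by_cases h : piFinite K ι v ∈ C x
    · simp only [B, indicator_of_mem h, Pi.one_apply, mul_one]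
      exact ⟨(b x).nonneg, (b x).le_one⟩
    · simp only [B, indicator_of_notMem h, mul_zero, mem_Icc, le_refl, zero_le_one, and_self]
  have hBone : ∀ x, ∀ v ∈ O x, B x v = 1 := fun x v hv => by
    have h2 : piFinite K ι v ∈ C x := hv.2
    simp only [B, indicator_of_mem h2, Pi.one_apply, mul_one]
    exact (b x).one_of_mem_closedBall (ball_subset_closedBall hv.1)
  have hBsupp : ∀ x, tsupport (B x) ⊆
      piArch K ι ⁻¹' closedBall (piArch K ι (x : ι → AdeleRing (𝓞 K) K)) (R x / 2) ∩
        piFinite K ι ⁻¹' C x := fun x => by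
    refine closure_minimal (fun v hv => ?_)
      ((isClosed_closedBall.preimage continuous_piArch).inter ((hCc x).isClosed.preimage
        continuous_piFinite))
    rw [Function.mem_support] at hv
    constructor
    · have h1 : (b x) (piArch K ι v) ≠ 0 := fun h => hv (by simp only [B, h, zero_mul])
      have : piArch K ι v ∈ Function.support (b x : (ι → mixedSpace K) → ℝ) := h1
      rw [(b x).support_eq] at this
      exact ball_subset_closedBall this
    · by_contra h
      have h' : piFinite K ι v ∉ C x := h
      exact hv (by simp only [B, indicator_of_notMem h', mul_zero])
  have hBU : ∀ x, tsupport (B x) ⊆ U := fun x v hv => by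
    have h := hBsupp x hv
    exact hbox x v (closedBall_subset_ball (by have := hR x; linarith) h.1) h.2
  have hBc : ∀ x, HasCompactSupport (B x) := fun x =>
    (isCompact_piAdeleBox _ _ (hCc x)).of_isClosed_subset (isClosed_tsupport _) (hBsupp x)
  have hBcont : ∀ x, Continuous (B x) := fun x => continuous_of_mem_piSchwartzBruhatReal (hBmem x)
  -- `Ψ = 1 - ∏_{x ∈ t} (1 - B x)`
  set Ψ : (ι → AdeleRing (𝓞 K) K) → ℝ := fun v => 1 - ∏ x ∈ t, (1 - B x v) with hΨ
  have hΨsupp : tsupport Ψ ⊆ ⋃ x ∈ t, tsupport (B x) := by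
    refine closure_minimal (fun v hv => ?_) (isClosed_biUnion_finset fun x _ => isClosed_tsupport _)
    rw [Function.mem_support] at hv
    obtain ⟨x, hxt, hx⟩ : ∃ x ∈ t, B x v ≠ 0 := by
      by_contra h
      push Not at h
      exact hv (by
        show 1 - ∏ x ∈ t, (1 - B x v) = 0
        rw [Finset.prod_eq_one (fun x hx => by rw [h x hx, sub_zero]), sub_self])
    exact mem_biUnion hxt (subset_tsupport _ hx)
  refine ⟨Ψ, ?_, ?_, ?_, fun v hv => ?_, fun v => ?_, fun v hv => ?_⟩
  · -- membership, by induction on `t`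
    rw [hΨ]
    clear hΨsupp hΨ ht
    induction t using Finset.induction_on with
    | empty =>
      simp only [Finset.prod_empty, sub_self]
      exact (piSchwartzBruhatReal K ι).zero_mem
    | insert a s ha ih =>
      have heq : (fun v => 1 - ∏ x ∈ insert a s, (1 - B x v)) =
          B a + (fun v => 1 - ∏ x ∈ s, (1 - B x v)) -
            B a * (fun v => 1 - ∏ x ∈ s, (1 - B x v)) := by
        funext v
        simp only [Finset.prod_insert ha, Pi.add_apply, Pi.sub_apply, Pi.mul_apply]
        ring
      rw [heq]
      exact sub_mem (add_mem (hBmem a) ih) (mul_mem_piSchwartzBruhatReal (hBmem a) ih)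
  · exact continuous_const.sub (continuous_finsetProd _ fun x _ => continuous_const.sub (hBcont x))
  · exact IsCompact.of_isClosed_subset (t.isCompact_biUnion fun x _ => hBc x) (isClosed_tsupport _)
      hΨsupp
  · obtain ⟨x, -, hx⟩ : ∃ x ∈ t, v ∈ tsupport (B x) := by
      simpa only [mem_iUnion, exists_prop] using hΨsupp hv
    exact hBU x hx
  · have hP : (∏ x ∈ t, (1 - B x v)) ∈ Icc (0 : ℝ) 1 :=
      ⟨Finset.prod_nonneg fun x _ => sub_nonneg.mpr (hB01 x v).2,
        Finset.prod_le_one (fun x _ => sub_nonneg.mpr (hB01 x v).2)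
          fun x _ => sub_le_self _ (hB01 x v).1⟩
    exact ⟨sub_nonneg.mpr hP.2, sub_le_self _ hP.1⟩
  · obtain ⟨x, hxt, hxO⟩ : ∃ x ∈ t, v ∈ O x := by simpa only [mem_iUnion, exists_prop] using ht hv
    show 1 - ∏ x ∈ t, (1 - B x v) = 1
    rw [Finset.prod_eq_zero hxt (by rw [hBone x v hxO, sub_self]), sub_zero]

/-! ### §3 Separation of points -/

/-- **`𝒮_ℝ(𝔸_K^ι)` separates points**: for `x ≠ y` there is a real Schwartz–Bruhat function, continuous,
with `Ψ x = 1` and `Ψ y = 0`. [cite: WeilBNT1967, Ch. VII §2] -/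
theorem exists_piSchwartzBruhatReal_apply_ne {x y : ι → AdeleRing (𝓞 K) K} (hxy : x ≠ y) :
    ∃ Ψ : (ι → AdeleRing (𝓞 K) K) → ℝ, Ψ ∈ piSchwartzBruhatReal K ι ∧ Continuous Ψ ∧
      Ψ x = 1 ∧ Ψ y = 0 := by
  haveI := t2Space_piAdele K ι
  obtain ⟨Ψ, hmem, hc, -, hsupp, -, hone⟩ := exists_piSchwartzBruhatReal_cutoff (K := K) (ι := ι)
    isCompact_singleton (isOpen_compl_singleton (x := y)) (singleton_subset_iff.mpr hxy)
  refine ⟨Ψ, hmem, hc, hone x rfl, ?_⟩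
  by_contra h
  exact hsupp (subset_tsupport _ h) rfl

/-! ### §4 Uniform density with support control -/

/-- The subalgebra of `C(K', ℝ)` (`K'` a compact subset of `𝔸_K^ι` carrying a function `Θ ∈ 𝒮_ℝ` with
`Θ = 1` on `K'`) of restrictions of continuous real Schwartz–Bruhat functions.
[cite: WeilBNT1967, Ch. VII §2] -/
def piSchwartzBruhatRealRestrict (K' : Set (ι → AdeleRing (𝓞 K) K)) {Θ : (ι → AdeleRing (𝓞 K) K) → ℝ}
    (hΘ : Θ ∈ piSchwartzBruhatReal K ι) (hΘc : Continuous Θ) (hΘ1 : ∀ v ∈ K', Θ v = 1) :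
    Subalgebra ℝ C(K', ℝ) where
  carrier := {f | ∃ Ψ : (ι → AdeleRing (𝓞 K) K) → ℝ, Ψ ∈ piSchwartzBruhatReal K ι ∧ Continuous Ψ ∧
    ∀ y : K', f y = Ψ y}
  mul_mem' := by
    rintro f g ⟨Ψ₁, h₁, h₁c, hf⟩ ⟨Ψ₂, h₂, h₂c, hg⟩
    exact ⟨Ψ₁ * Ψ₂, mul_mem_piSchwartzBruhatReal h₁ h₂, h₁c.mul h₂c, fun y => by
      rw [ContinuousMap.mul_apply, hf, hg, Pi.mul_apply]⟩
  add_mem' := by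
    rintro f g ⟨Ψ₁, h₁, h₁c, hf⟩ ⟨Ψ₂, h₂, h₂c, hg⟩
    exact ⟨Ψ₁ + Ψ₂, add_mem h₁ h₂, h₁c.add h₂c, fun y => by
      rw [ContinuousMap.add_apply, hf, hg, Pi.add_apply]⟩
  algebraMap_mem' r :=
    ⟨r • Θ, (piSchwartzBruhatReal K ι).smul_mem r hΘ, hΘc.const_smul r, fun y => by
      rw [Pi.smul_apply, hΘ1 y y.2, smul_eq_mul, mul_one]; rfl⟩

/-- The restriction subalgebra separates points. [cite: WeilBNT1967, Ch. VII §2] -/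
theorem separatesPoints_piSchwartzBruhatRealRestrict (K' : Set (ι → AdeleRing (𝓞 K) K))
    {Θ : (ι → AdeleRing (𝓞 K) K) → ℝ} (hΘ : Θ ∈ piSchwartzBruhatReal K ι) (hΘc : Continuous Θ)
    (hΘ1 : ∀ v ∈ K', Θ v = 1) : (piSchwartzBruhatRealRestrict K' hΘ hΘc hΘ1).SeparatesPoints := by
  intro y₁ y₂ hne
  obtain ⟨Ψ, hmem, hc, h1, h0⟩ := exists_piSchwartzBruhatReal_apply_ne (K := K) (ι := ι)
    (fun h => hne (Subtype.ext h))
  refine ⟨fun y => Ψ y, ⟨⟨fun y : K' => Ψ y, hc.comp continuous_subtype_val⟩,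
    ⟨Ψ, hmem, hc, fun _ => rfl⟩, rfl⟩, ?_⟩
  simp only [h1, h0, ne_eq, one_ne_zero, not_false_eq_true]

/-- **Uniform density of `𝒮_ℝ(𝔸_K^ι)` in `C_c(𝔸_K^ι, ℝ)` with support control.** For `g ∈ C_c(X, ℝ)`
with `tsupport g ⊆ U`, `U` open, and `ε > 0` there is a continuous compactly supported real
Schwartz–Bruhat `Ψ` with `tsupport Ψ ⊆ U` and `|Ψ - g| ≤ ε` everywhere. (Cut-off `Ψ_c = 1` on
`tsupport g`; Stone–Weierstrass on the compact `tsupport Ψ_c`; multiply back by `Ψ_c`.)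
[cite: Weil1965, Chap. I n° 2, Lemme 3, p. 7] -/
theorem exists_piSchwartzBruhatReal_near (g : C_c(ι → AdeleRing (𝓞 K) K, ℝ))
    {U : Set (ι → AdeleRing (𝓞 K) K)} (hU : IsOpen U) (hgU : tsupport g ⊆ U) {ε : ℝ}
    (hε : 0 < ε) :
    ∃ Ψ : (ι → AdeleRing (𝓞 K) K) → ℝ, Ψ ∈ piSchwartzBruhatReal K ι ∧ Continuous Ψ ∧
      HasCompactSupport Ψ ∧ tsupport Ψ ⊆ U ∧ ∀ v, |Ψ v - g v| ≤ ε := by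
  -- cut-off of `tsupport g`
  obtain ⟨Ψc, hcmem, hcc, hcsupp, hcU, hc01, hc1⟩ :=
    exists_piSchwartzBruhatReal_cutoff (K := K) (ι := ι) g.hasCompactSupport hU hgU
  set K' : Set (ι → AdeleRing (𝓞 K) K) := tsupport Ψc
  have hK'c : IsCompact K' := hcsupp
  haveI : CompactSpace K' := isCompact_iff_compactSpace.mp hK'c
  -- a Schwartz–Bruhat function equal to `1` on `K'`
  obtain ⟨Θ, hΘ, hΘc, -, -, -, hΘ1⟩ :=
    exists_piSchwartzBruhatReal_cutoff (K := K) (ι := ι) hK'c isOpen_univ (subset_univ _)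
  -- Stone–Weierstrass on `K'`
  set A := piSchwartzBruhatRealRestrict K' hΘ hΘc hΘ1
  obtain ⟨f, hf⟩ := ContinuousMap.exists_mem_subalgebra_near_continuousMap_of_separatesPoints A
    (separatesPoints_piSchwartzBruhatRealRestrict K' hΘ hΘc hΘ1) ((g : C(_, ℝ)).restrict K') ε hε
  obtain ⟨Ψ, hΨ, hΨc, hfΨ⟩ := f.2
  have hnear : ∀ y : K', |Ψ y - g y| ≤ ε := fun y => by
    have h := ((f : C(K', ℝ)) - (g : C(_, ℝ)).restrict K').norm_coe_le_norm y
    rw [ContinuousMap.sub_apply, ContinuousMap.restrict_apply, Real.norm_eq_abs, hfΨ y] at h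
    exact h.trans hf.le
  refine ⟨Ψ * Ψc, mul_mem_piSchwartzBruhatReal hΨ hcmem, hΨc.mul hcc, hcsupp.mul_left,
    (tsupport_mul_subset_right).trans hcU, fun v => ?_⟩
  -- `g = g · Ψc` everywhere
  have hg : g v = g v * Ψc v := by
    by_cases hv : v ∈ tsupport g
    · rw [hc1 v hv, mul_one]
    · rw [image_eq_zero_of_notMem_tsupport hv, zero_mul]
  by_cases hv : v ∈ K'
  · rw [Pi.mul_apply, hg, ← sub_mul, abs_mul, abs_of_nonneg (hc01 v).1]
    exact (mul_le_of_le_one_right (abs_nonneg _) (hc01 v).2).trans (hnear ⟨v, hv⟩)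
  · have h0 : Ψc v = 0 := image_eq_zero_of_notMem_tsupport hv
    rw [Pi.mul_apply, hg, h0, mul_zero, mul_zero, sub_zero, abs_zero]
    exact hε.le

/-! ### §5 The Darboux–Daniell sandwich for positive functionals on `𝒮_ℝ(𝔸_K^ι)` -/

/-- **Sandwiches.** For every positive linear functional `S` on `𝒮_ℝ(𝔸_K^ι)`, every
`g ∈ C_c(𝔸_K^ι, ℝ)` with `tsupport g ⊆ U` (`U` open) and every `ε > 0` there are continuous,
compactly supported `Ψ₁ ≤ g ≤ Ψ₂` in `𝒮_ℝ(𝔸_K^ι)` with supports inside `U` and `S Ψ₂ ≤ S Ψ₁ + ε`.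
[cite: Weil1965, Chap. I n° 2, Lemme 3, p. 7] -/
theorem piSchwartzBruhatReal_sandwich_of_subset (S : piSchwartzBruhatReal K ι →ₗ[ℝ] ℝ)
    (hS : ∀ Ψ : piSchwartzBruhatReal K ι, 0 ≤ (Ψ : (ι → AdeleRing (𝓞 K) K) → ℝ) → 0 ≤ S Ψ)
    (g : C_c(ι → AdeleRing (𝓞 K) K, ℝ)) {U : Set (ι → AdeleRing (𝓞 K) K)} (hU : IsOpen U)
    (hgU : tsupport g ⊆ U) {ε : ℝ} (hε : 0 < ε) :
    ∃ Ψ₁ Ψ₂ : piSchwartzBruhatReal K ι,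
      (Ψ₁ : (ι → AdeleRing (𝓞 K) K) → ℝ) ≤ g ∧ (g : (ι → AdeleRing (𝓞 K) K) → ℝ) ≤ Ψ₂ ∧
      S Ψ₂ ≤ S Ψ₁ + ε ∧
      Continuous (Ψ₁ : (ι → AdeleRing (𝓞 K) K) → ℝ) ∧ Continuous (Ψ₂ : (ι → AdeleRing (𝓞 K) K) → ℝ) ∧
      HasCompactSupport (Ψ₁ : (ι → AdeleRing (𝓞 K) K) → ℝ) ∧
      HasCompactSupport (Ψ₂ : (ι → AdeleRing (𝓞 K) K) → ℝ) ∧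
      tsupport (Ψ₁ : (ι → AdeleRing (𝓞 K) K) → ℝ) ⊆ U ∧
      tsupport (Ψ₂ : (ι → AdeleRing (𝓞 K) K) → ℝ) ⊆ U := by
  haveI := t2Space_piAdele K ι
  haveI := locallyCompactSpace_adeleRing' (K := K)
  -- a compact `L` with `tsupport g ⊆ interior L`, `L ⊆ U`, and its cut-off `Θ`
  obtain ⟨L, hLc, hgL, hLU⟩ := exists_compact_between g.hasCompactSupport hU hgU
  obtain ⟨Θ, hΘ, hΘc, hΘs, hΘU, hΘ01, hΘ1⟩ :=
    exists_piSchwartzBruhatReal_cutoff (K := K) (ι := ι) hLc hU hLU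
  set M : ℝ := S ⟨Θ, hΘ⟩
  have hM : 0 ≤ M := hS ⟨Θ, hΘ⟩ fun v => (hΘ01 v).1
  set δ : ℝ := ε / (2 * M + 1)
  have hδ : 0 < δ := div_pos hε (by linarith)
  have hδM : 2 * δ * M ≤ ε := by
    rw [show 2 * δ * M = ε * (2 * M / (2 * M + 1)) by simp only [δ]; ring]
    refine (mul_le_mul_of_nonneg_left ?_ hε.le).trans_eq (mul_one ε)
    rw [div_le_one (by linarith)]
    linarith
  -- uniform approximation inside `interior L`
  obtain ⟨Ψ, hΨ, hΨc, hΨs, hΨL, hnear⟩ :=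
    exists_piSchwartzBruhatReal_near (K := K) (ι := ι) g isOpen_interior hgL hδ
  have hΨL' : tsupport Ψ ⊆ L := hΨL.trans interior_subset
  have hsub : ∀ F : (ι → AdeleRing (𝓞 K) K) → ℝ,
      Function.support F ⊆ Function.support Ψ ∪ Function.support Θ → tsupport F ⊆ U := fun F hF =>
    (closure_minimal (hF.trans (union_subset_union (subset_tsupport _) (subset_tsupport _)))
      ((isClosed_tsupport _).union (isClosed_tsupport _))).trans
      (union_subset (hΨL'.trans hLU) hΘU)
  refine ⟨⟨Ψ - δ • Θ, sub_mem hΨ ((piSchwartzBruhatReal K ι).smul_mem δ hΘ)⟩,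
    ⟨Ψ + δ • Θ, add_mem hΨ ((piSchwartzBruhatReal K ι).smul_mem δ hΘ)⟩,
    fun v => ?_, fun v => ?_, ?_, hΨc.sub (hΘc.const_smul δ), hΨc.add (hΘc.const_smul δ),
    hΨs.sub (hΘs.smul_left (f := fun _ => δ)), hΨs.add (hΘs.smul_left (f := fun _ => δ)),
    ?_, ?_⟩
  · -- `Ψ - δ Θ ≤ g`
    show Ψ v - δ * Θ v ≤ g v
    by_cases hv : v ∈ L
    · rw [hΘ1 v hv, mul_one]
      have := (abs_le.mp (hnear v)).2
      linarith
    · rw [image_eq_zero_of_notMem_tsupport fun h => hv (hΨL' h),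
        image_eq_zero_of_notMem_tsupport fun h => hv (interior_subset (hgL h))]
      have := mul_nonneg hδ.le (hΘ01 v).1
      linarith
  · -- `g ≤ Ψ + δ Θ`
    show g v ≤ Ψ v + δ * Θ v
    by_cases hv : v ∈ L
    · rw [hΘ1 v hv, mul_one]
      have := (abs_le.mp (hnear v)).1
      linarith
    · rw [image_eq_zero_of_notMem_tsupport fun h => hv (hΨL' h),
        image_eq_zero_of_notMem_tsupport fun h => hv (interior_subset (hgL h))]
      have := mul_nonneg hδ.le (hΘ01 v).1
      linarith
  · -- `S Ψ₂ - S Ψ₁ = 2 δ M`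
    have h : S ⟨Ψ + δ • Θ, add_mem hΨ ((piSchwartzBruhatReal K ι).smul_mem δ hΘ)⟩ =
        S ⟨Ψ - δ • Θ, sub_mem hΨ ((piSchwartzBruhatReal K ι).smul_mem δ hΘ)⟩ + 2 * δ * M := by
      have h2 : (⟨Ψ + δ • Θ, add_mem hΨ ((piSchwartzBruhatReal K ι).smul_mem δ hΘ)⟩ :
          piSchwartzBruhatReal K ι) =
          ⟨Ψ - δ • Θ, sub_mem hΨ ((piSchwartzBruhatReal K ι).smul_mem δ hΘ)⟩ +
            (2 * δ) • (⟨Θ, hΘ⟩ : piSchwartzBruhatReal K ι) := by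
        apply Subtype.ext
        simp only [Submodule.coe_add, Submodule.coe_smul]
        funext v
        simp only [Pi.add_apply, Pi.sub_apply, Pi.smul_apply, smul_eq_mul]
        ring
      rw [h2, map_add, map_smul, smul_eq_mul]
    rw [h]
    linarith
  · exact hsub _ fun v hv => by
      by_contra h
      simp only [mem_union, Function.mem_support, not_or, not_not] at h
      exact hv (by simp only [Pi.sub_apply, Pi.smul_apply, smul_eq_mul, h.1, h.2, mul_zero,
        sub_zero])
  · exact hsub _ fun v hv => by
      by_contra h
      simp only [mem_union, Function.mem_support, not_or, not_not] at h
      exact hv (by simp only [Pi.add_apply, Pi.smul_apply, smul_eq_mul, h.1, h.2, mul_zero,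
        add_zero])

/-- **The sandwich hypothesis `hL` of `PositiveFunctionalExtension` for `L = 𝒮_ℝ(𝔸_K^ι)`**: every
positive linear functional on the real Schwartz–Bruhat functions sandwiches `C_c(𝔸_K^ι, ℝ)`.
[cite: Weil1965, Chap. I n° 2, Lemme 3, p. 7] -/
theorem piSchwartzBruhatReal_sandwich (S : piSchwartzBruhatReal K ι →ₗ[ℝ] ℝ)
    (hS : ∀ Ψ : piSchwartzBruhatReal K ι, 0 ≤ (Ψ : (ι → AdeleRing (𝓞 K) K) → ℝ) → 0 ≤ S Ψ)
    (g : C_c(ι → AdeleRing (𝓞 K) K, ℝ)) (ε : ℝ) (hε : 0 < ε) :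
    ∃ Ψ₁ Ψ₂ : piSchwartzBruhatReal K ι,
      (Ψ₁ : (ι → AdeleRing (𝓞 K) K) → ℝ) ≤ g ∧ (g : (ι → AdeleRing (𝓞 K) K) → ℝ) ≤ Ψ₂ ∧
      S Ψ₂ ≤ S Ψ₁ + ε := by
  obtain ⟨Ψ₁, Ψ₂, h₁, h₂, h, -⟩ :=
    piSchwartzBruhatReal_sandwich_of_subset S hS g isOpen_univ (subset_univ _) hε
  exact ⟨Ψ₁, Ψ₂, h₁, h₂, h⟩

end Literature.NumberTheory.Automorphic
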